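import Literature.NumberTheory.LFunctions.FeketePolyaKernelCertificatesBlockWrappers
import HarnessLib

/-!
# No real zero for real primitive characters of conductor `16568 ≤ q ≤ 17452`: the Fekete–Pólya rows, in the kernel (rows deferred by the earlier engines)

Topic `Literature/NumberTheory/LFunctions`; namespace `Literature.NumberTheory.LFunctions`. THEOREMS only (no
definition, no named fact, no `sorry`; standard axioms): one PUBLIC theorem **`noRealZero{Odd,Even}_fp_<q>`** per
fundamental discriminant `D`, `|D| = q ∈ [16568, 17452]`, that admits a Fekete–Pólya witness but was DEFERRED by the per-position engines v1/v2 (walk too long for one `decide`) — for every primitive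
quadratic `χ` mod `q` of the parity of `D` and every `σ ∈ (0, 1)`, `L(σ, χ) ≠ 0` (statement shape of the
`interval_cases` bullets of the `NoRealZero{Odd,Even}…` range files, so a range assembly cites them by name).
Cell `parity-realchar`, kernel floor of the wide column (TARGET §2 row 19), Fekete–Pólya lane (seat prover-2).

Method (engine v4): `FeketePolyaKernelCertificatesBlock{,Wrappers}.lean` — the iterated partial sums of order
`K` of the induced character `χ↑(q·w)` are non-negative over one period, decided in the kernel BLOCKWISE on packed
base-`2^b` digits (`blockCert b B K (q·w) (tabs… b ps q w)`: sign tables of the character from the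
quadratic-residue bitsets of the prime factors of the conductor — the factor list is part of each certificate,
primality by `norm_num` — prefix sums by one big-integer multiplication per order and block, sign test by one
AND), hence `ℜL(σ, χ↑(q·w)) > 0` (Fekete–Pólya 1912 / MV §11.2.1 Exercise 7) and `L(σ, χ) ≠ 0` (positive Euler
factors, Exercise 8).  Witnesses `(w, K)` = the cheapest in the exact integer scan of this seat
(`HOME/parity-realchar-prover-2/fp-witnesses-*.tsv`; no kit); the digit width `b` is two bits above the size of
the running-sum bound recorded by the scan.  17 characters in this file (est. 78 kernel-s).
NOT covered here (no Fekete–Pólya witness with `w ≤ 40`, `q·w ≤ 4·10⁵`, `K ≤ 12`; the other Fekete–Pólya rows of this range are in the `NoRealZeroFeketePolyaX…` files) — left to the truncation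
certificates of the companion lane: see those files.

## References

* H. L. Montgomery, R. C. Vaughan, *Multiplicative Number Theory I*, CUP 2007, §9.3 Thm 9.13, §11.2.1
  Exercises 7–8. [MontgomeryVaughan2007]
* M. Fekete, G. Pólya, *Über ein Problem von Laguerre*, Rend. Circ. Mat. Palermo 34 (1912) 89–120. [FeketePolya1912]
-/

namespace Literature.NumberTheory.LFunctions

open FeketePolyaKernel

set_option maxHeartbeats 400000 in
/-- `D = -16568`: the odd character `χ₈·(·/2071)` of conductor `16568` (`2071`: 19 · 109) — Fekete–Pólya witness of order `8` along the induced modulus `16568·13 = 215384`, block certificate (digits of `121` bits, splitting depth `10`); est. `9.6` kernel-s. [cite: MontgomeryVaughan2007, §11.2.1 Exercises 7 (g), 8] -/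
theorem noRealZeroOdd_fp_16568 :
    ∀ χ : DirichletCharacter ℂ 16568, χ.IsQuadratic → χ.IsPrimitive → χ.Odd →
      ∀ σ : ℝ, 0 < σ → σ < 1 → χ.LFunction σ ≠ 0 :=
  good_odd_of_eight_blk [19, 109] (by norm_num) (by decide) (by decide) 13 8 121 10 (by decide) (by decide) (by decide)
    (Or.inl (by decide +kernel)) (Or.inr (by decide +kernel))

set_option maxHeartbeats 400000 in
/-- `D = 16653`: the even character `(·/16653)` of conductor `16653` (`16653`: 3 · 7 · 13 · 61) — Fekete–Pólya witness of order `5` along the induced modulus `16653·10 = 166530`, block certificate (digits of `72` bits, splitting depth `10`); est. `4.0` kernel-s. [cite: MontgomeryVaughan2007, §11.2.1 Exercises 7 (g), 8] -/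
theorem noRealZeroEven_fp_16653 :
    ∀ χ : DirichletCharacter ℂ 16653, χ.IsQuadratic → χ.IsPrimitive → χ.Even →
      ∀ σ : ℝ, 0 < σ → σ < 1 → χ.LFunction σ ≠ 0 :=
  good_even_of_odd_blk [3, 7, 13, 61] (by norm_num) (by decide) (by decide) 10 5 72 10 (by decide) (by decide) (by decide)
    (Or.inr (by decide +kernel))

set_option maxHeartbeats 400000 in
/-- `D = 16712`: the even character `χ₈·(·/2089)` of conductor `16712` (`2089`: prime) — Fekete–Pólya witness of order `3` along the induced modulus `16712·15 = 250680`, block certificate (digits of `42` bits, splitting depth `9`); est. `2.5` kernel-s. [cite: MontgomeryVaughan2007, §11.2.1 Exercises 7 (g), 8] -/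
theorem noRealZeroEven_fp_16712 :
    ∀ χ : DirichletCharacter ℂ 16712, χ.IsQuadratic → χ.IsPrimitive → χ.Even →
      ∀ σ : ℝ, 0 < σ → σ < 1 → χ.LFunction σ ≠ 0 :=
  good_even_of_eight_blk [2089] (by norm_num) (by decide) (by decide) 15 3 42 9 (by decide) (by decide) (by decide)
    (Or.inl (by decide +kernel)) (Or.inr (by decide +kernel))

set_option maxHeartbeats 400000 in
/-- `D = -16779`: the odd character `(·/16779)` of conductor `16779` (`16779`: 3 · 7 · 17 · 47) — Fekete–Pólya witness of order `4` along the induced modulus `16779·11 = 184569`, block certificate (digits of `58` bits, splitting depth `9`); est. `2.5` kernel-s. [cite: MontgomeryVaughan2007, §11.2.1 Exercises 7 (g), 8] -/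
theorem noRealZeroOdd_fp_16779 :
    ∀ χ : DirichletCharacter ℂ 16779, χ.IsQuadratic → χ.IsPrimitive → χ.Odd →
      ∀ σ : ℝ, 0 < σ → σ < 1 → χ.LFunction σ ≠ 0 :=
  good_odd_of_odd_blk [3, 7, 17, 47] (by norm_num) (by decide) (by decide) 11 4 58 9 (by decide) (by decide) (by decide)
    (Or.inr (by decide +kernel))

set_option maxHeartbeats 400000 in
/-- `D = -16804`: the odd character `χ₋₄·(·/4201)` of conductor `16804` (`4201`: prime) — Fekete–Pólya witness of order `7` along the induced modulus `16804·7 = 117628`, block certificate (digits of `100` bits, splitting depth `9`); est. `4.4` kernel-s. [cite: MontgomeryVaughan2007, §11.2.1 Exercises 7 (g), 8] -/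
theorem noRealZeroOdd_fp_16804 :
    ∀ χ : DirichletCharacter ℂ 16804, χ.IsQuadratic → χ.IsPrimitive → χ.Odd →
      ∀ σ : ℝ, 0 < σ → σ < 1 → χ.LFunction σ ≠ 0 :=
  good_odd_of_four_blk [4201] (by norm_num) (by decide) (by decide) 7 7 100 9 (by decide) (by decide) (by decide)
    (Or.inr (by decide +kernel))

set_option maxHeartbeats 400000 in
/-- `D = 16837`: the even character `(·/16837)` of conductor `16837` (`16837`: 113 · 149) — Fekete–Pólya witness of order `6` along the induced modulus `16837·11 = 185207`, block certificate (digits of `88` bits, splitting depth `10`); est. `5.4` kernel-s. [cite: MontgomeryVaughan2007, §11.2.1 Exercises 7 (g), 8] -/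
theorem noRealZeroEven_fp_16837 :
    ∀ χ : DirichletCharacter ℂ 16837, χ.IsQuadratic → χ.IsPrimitive → χ.Even →
      ∀ σ : ℝ, 0 < σ → σ < 1 → χ.LFunction σ ≠ 0 :=
  good_even_of_odd_blk [113, 149] (by norm_num) (by decide) (by decide) 11 6 88 10 (by decide) (by decide) (by decide)
    (Or.inr (by decide +kernel))

set_option maxHeartbeats 400000 in
/-- `D = -17032`: the odd character `χ₋₈·(·/2129)` of conductor `17032` (`2129`: prime) — Fekete–Pólya witness of order `7` along the induced modulus `17032·21 = 357672`, block certificate (digits of `110` bits, splitting depth `11`); est. `13.3` kernel-s. [cite: MontgomeryVaughan2007, §11.2.1 Exercises 7 (g), 8] -/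
theorem noRealZeroOdd_fp_17032 :
    ∀ χ : DirichletCharacter ℂ 17032, χ.IsQuadratic → χ.IsPrimitive → χ.Odd →
      ∀ σ : ℝ, 0 < σ → σ < 1 → χ.LFunction σ ≠ 0 :=
  good_odd_of_eight_blk [2129] (by norm_num) (by decide) (by decide) 21 7 110 11 (by decide) (by decide) (by decide)
    (Or.inr (by decide +kernel)) (Or.inl (by decide +kernel))

set_option maxHeartbeats 400000 in
/-- `D = 17096`: the even character `χ₈·(·/2137)` of conductor `17096` (`2137`: prime) — Fekete–Pólya witness of order `5` along the induced modulus `17096·11 = 188056`, block certificate (digits of `73` bits, splitting depth `10`); est. `4.6` kernel-s. [cite: MontgomeryVaughan2007, §11.2.1 Exercises 7 (g), 8] -/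
theorem noRealZeroEven_fp_17096 :
    ∀ χ : DirichletCharacter ℂ 17096, χ.IsQuadratic → χ.IsPrimitive → χ.Even →
      ∀ σ : ℝ, 0 < σ → σ < 1 → χ.LFunction σ ≠ 0 :=
  good_even_of_eight_blk [2137] (by norm_num) (by decide) (by decide) 11 5 73 10 (by decide) (by decide) (by decide)
    (Or.inl (by decide +kernel)) (Or.inr (by decide +kernel))

set_option maxHeartbeats 400000 in
/-- `D = 17113`: the even character `(·/17113)` of conductor `17113` (`17113`: 109 · 157) — Fekete–Pólya witness of order `7` along the induced modulus `17113·7 = 119791`, block certificate (digits of `100` bits, splitting depth `9`); est. `4.3` kernel-s. [cite: MontgomeryVaughan2007, §11.2.1 Exercises 7 (g), 8] -/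
theorem noRealZeroEven_fp_17113 :
    ∀ χ : DirichletCharacter ℂ 17113, χ.IsQuadratic → χ.IsPrimitive → χ.Even →
      ∀ σ : ℝ, 0 < σ → σ < 1 → χ.LFunction σ ≠ 0 :=
  good_even_of_odd_blk [109, 157] (by norm_num) (by decide) (by decide) 7 7 100 9 (by decide) (by decide) (by decide)
    (Or.inr (by decide +kernel))

set_option maxHeartbeats 400000 in
/-- `D = 17129`: the even character `(·/17129)` of conductor `17129` (`17129`: 7 · 2447) — Fekete–Pólya witness of order `2` along the induced modulus `17129·11 = 188419`, block certificate (digits of `24` bits, splitting depth `8`); est. `1.0` kernel-s. [cite: MontgomeryVaughan2007, §11.2.1 Exercises 7 (g), 8] -/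
theorem noRealZeroEven_fp_17129 :
    ∀ χ : DirichletCharacter ℂ 17129, χ.IsQuadratic → χ.IsPrimitive → χ.Even →
      ∀ σ : ℝ, 0 < σ → σ < 1 → χ.LFunction σ ≠ 0 :=
  good_even_of_odd_blk [7, 2447] (by norm_num) (by decide) (by decide) 11 2 24 8 (by decide) (by decide) (by decide)
    (Or.inr (by decide +kernel))

set_option maxHeartbeats 400000 in
/-- `D = 17132`: the even character `χ₋₄·(·/4283)` of conductor `17132` (`4283`: prime) — Fekete–Pólya witness of order `3` along the induced modulus `17132·15 = 256980`, block certificate (digits of `42` bits, splitting depth `9`); est. `2.6` kernel-s. [cite: MontgomeryVaughan2007, §11.2.1 Exercises 7 (g), 8] -/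
theorem noRealZeroEven_fp_17132 :
    ∀ χ : DirichletCharacter ℂ 17132, χ.IsQuadratic → χ.IsPrimitive → χ.Even →
      ∀ σ : ℝ, 0 < σ → σ < 1 → χ.LFunction σ ≠ 0 :=
  good_even_of_four_blk [4283] (by norm_num) (by decide) (by decide) 15 3 42 9 (by decide) (by decide) (by decide)
    (Or.inr (by decide +kernel))

set_option maxHeartbeats 400000 in
/-- `D = 17205`: the even character `(·/17205)` of conductor `17205` (`17205`: 3 · 5 · 31 · 37) — Fekete–Pólya witness of order `6` along the induced modulus `17205·7 = 120435`, block certificate (digits of `84` bits, splitting depth `9`); est. `3.5` kernel-s. [cite: MontgomeryVaughan2007, §11.2.1 Exercises 7 (g), 8] -/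
theorem noRealZeroEven_fp_17205 :
    ∀ χ : DirichletCharacter ℂ 17205, χ.IsQuadratic → χ.IsPrimitive → χ.Even →
      ∀ σ : ℝ, 0 < σ → σ < 1 → χ.LFunction σ ≠ 0 :=
  good_even_of_odd_blk [3, 5, 31, 37] (by norm_num) (by decide) (by decide) 7 6 84 9 (by decide) (by decide) (by decide)
    (Or.inr (by decide +kernel))

set_option maxHeartbeats 400000 in
/-- `D = 17213`: the even character `(·/17213)` of conductor `17213` (`17213`: 7 · 2459) — Fekete–Pólya witness of order `7` along the induced modulus `17213·10 = 172130`, block certificate (digits of `102` bits, splitting depth `10`); est. `6.3` kernel-s. [cite: MontgomeryVaughan2007, §11.2.1 Exercises 7 (g), 8] -/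
theorem noRealZeroEven_fp_17213 :
    ∀ χ : DirichletCharacter ℂ 17213, χ.IsQuadratic → χ.IsPrimitive → χ.Even →
      ∀ σ : ℝ, 0 < σ → σ < 1 → χ.LFunction σ ≠ 0 :=
  good_even_of_odd_blk [7, 2459] (by norm_num) (by decide) (by decide) 10 7 102 10 (by decide) (by decide) (by decide)
    (Or.inr (by decide +kernel))

set_option maxHeartbeats 400000 in
/-- `D = -17295`: the odd character `(·/17295)` of conductor `17295` (`17295`: 3 · 5 · 1153) — Fekete–Pólya witness of order `3` along the induced modulus `17295·11 = 190245`, block certificate (digits of `44` bits, splitting depth `9`); est. `1.9` kernel-s. [cite: MontgomeryVaughan2007, §11.2.1 Exercises 7 (g), 8] -/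
theorem noRealZeroOdd_fp_17295 :
    ∀ χ : DirichletCharacter ℂ 17295, χ.IsQuadratic → χ.IsPrimitive → χ.Odd →
      ∀ σ : ℝ, 0 < σ → σ < 1 → χ.LFunction σ ≠ 0 :=
  good_odd_of_odd_blk [3, 5, 1153] (by norm_num) (by decide) (by decide) 11 3 44 9 (by decide) (by decide) (by decide)
    (Or.inr (by decide +kernel))

set_option maxHeartbeats 400000 in
/-- `D = -17428`: the odd character `χ₋₄·(·/4357)` of conductor `17428` (`4357`: prime) — Fekete–Pólya witness of order `6` along the induced modulus `17428·5 = 87140`, block certificate (digits of `83` bits, splitting depth `9`); est. `2.8` kernel-s. [cite: MontgomeryVaughan2007, §11.2.1 Exercises 7 (g), 8] -/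
theorem noRealZeroOdd_fp_17428 :
    ∀ χ : DirichletCharacter ℂ 17428, χ.IsQuadratic → χ.IsPrimitive → χ.Odd →
      ∀ σ : ℝ, 0 < σ → σ < 1 → χ.LFunction σ ≠ 0 :=
  good_odd_of_four_blk [4357] (by norm_num) (by decide) (by decide) 5 6 83 9 (by decide) (by decide) (by decide)
    (Or.inr (by decide +kernel))

set_option maxHeartbeats 400000 in
/-- `D = 17445`: the even character `(·/17445)` of conductor `17445` (`17445`: 3 · 5 · 1163) — Fekete–Pólya witness of order `7` along the induced modulus `17445·11 = 191895`, block certificate (digits of `103` bits, splitting depth `10`); est. `6.9` kernel-s. [cite: MontgomeryVaughan2007, §11.2.1 Exercises 7 (g), 8] -/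
theorem noRealZeroEven_fp_17445 :
    ∀ χ : DirichletCharacter ℂ 17445, χ.IsQuadratic → χ.IsPrimitive → χ.Even →
      ∀ σ : ℝ, 0 < σ → σ < 1 → χ.LFunction σ ≠ 0 :=
  good_even_of_odd_blk [3, 5, 1163] (by norm_num) (by decide) (by decide) 11 7 103 10 (by decide) (by decide) (by decide)
    (Or.inr (by decide +kernel))

set_option maxHeartbeats 400000 in
/-- `D = -17448`: the odd character `χ₋₈·(·/2181)` of conductor `17448` (`2181`: 3 · 727) — Fekete–Pólya witness of order `5` along the induced modulus `17448·5 = 87240`, block certificate (digits of `69` bits, splitting depth `9`); est. `2.2` kernel-s. [cite: MontgomeryVaughan2007, §11.2.1 Exercises 7 (g), 8] -/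
theorem noRealZeroOdd_fp_17448 :
    ∀ χ : DirichletCharacter ℂ 17448, χ.IsQuadratic → χ.IsPrimitive → χ.Odd →
      ∀ σ : ℝ, 0 < σ → σ < 1 → χ.LFunction σ ≠ 0 :=
  good_odd_of_eight_blk [3, 727] (by norm_num) (by decide) (by decide) 5 5 69 9 (by decide) (by decide) (by decide)
    (Or.inr (by decide +kernel)) (Or.inl (by decide +kernel))

end Literature.NumberTheory.LFunctions
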